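import Summits.CriticalPhenomena.Ising3DConformalLimit.Theorems.MonotoneBlockingMonotoneBlockingTwoKarlinComposition
import HarnessLib

/-!
# `BlockTP2` for scale-totally-positive kernels (line `Sketch`, crux `MonotoneBlockingTwo`, stmt-CriticalPhenomena-17054)

Route `MonotoneBlocking`, sub-problem `CriticalPhenomena/Ising3DConformalLimit`. The composition argument of line `Sketch`
(idea `karlin-scale-tp2`) proves more than the BM₂ shape: for `Γ ∈ 𝒦` and `N ≥ 0` the block covariance of
`G = Γ⋆T + N·𝟙₀` is TP₂ in (block side, coordinatewise offset magnitude) —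
`bc_G(L,k')·bc_G(L',k) ≤ bc_G(L,k)·bc_G(L',k')` for `1 ≤ L ≤ L'` and `|kᵢ| ≤ |k'ᵢ|` (`BlockTP2 G`, Defs §4): the ratio
`ρ_G(L;k')/ρ_G(L;k)` is non-decreasing in `L` whenever `k'` dominates `k` coordinatewise. This is the card's TESTABLE
PREDICTION (its falsifier F1: MC ratios `ρ(L;2e₁)/ρ(L;e₁) = 0.4908, 0.5045, 0.5153, 0.5256`, `L = 1…4`, consistent) and the
registered sub-goal `blockTP2` of the crux item. Proof: the MTP₂ comparison of `stub_foldedBlockIntegral_tp2` at `(L,|k'|)`,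
`(L',|k|)` (join `(L',|k'|)`, meet `(L,|k|)`), the cubic column for the nugget (`cubic_mono`), and the `ℝ≥0∞ → ℝ`
bookkeeping of `…KarlinComposition`.
-/

noncomputable section

namespace Summit.CriticalPhenomena.Ising3DConformalLimit.Cruxes.MonotoneBlockingTwo.KarlinScaleTP2

open MeasureTheory Set
open scoped BigOperators ENNReal
open Literature.Probability.LatticeModels

/-- Coordinatewise domination of offsets gives domination of the absolute offsets (as `Fin 3 → ℕ`). -/
theorem natAbs_le_of_abs_le {k k' : Site 3} (h : ∀ i, |k i| ≤ |k' i|) :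
    (fun i => (k i).natAbs) ≤ (fun i => (k' i).natAbs) := by
  intro i
  have := h i
  rw [Int.abs_eq_natAbs, Int.abs_eq_natAbs] at this
  exact_mod_cast this

/-- If `k'` dominates `k` coordinatewise in absolute value and `k' = 0` then `k = 0`. -/
theorem eq_zero_of_abs_le_zero {k k' : Site 3} (h : ∀ i, |k i| ≤ |k' i|) (hk' : k' = 0) : k = 0 := by
  funext i
  have := h i
  rw [hk'] at this
  simpa using this

/-- **BlockTP2 for the class** (registered sub-goal `blockTP2`): for `Γ ∈ 𝒦` and `N ≥ 0`, the block covariance of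
`Γ⋆T + N·𝟙₀` is TP₂ in (block side, coordinatewise offset magnitude). -/
theorem blockTP2 : ∀ (Γ : ℝ → ℝ → ℝ → ℝ) (N : ℝ), KarlinClass Γ → 0 ≤ N →
    BlockTP2 (fun z => cellSmear Γ z + if z = 0 then N else 0) := by
  intro Γ N hK hN L L' hL hLL' k k' hkk'
  have hL' : 1 ≤ L' := le_trans hL hLL'
  have h4 := stub_convolution1D
  have h5 := stub_blockSum_cellSmear
  have h6 := stub_fold
  -- the TP₂ engine at (L,|k'|), (L',|k|): join (L',|k'|), meet (L,|k|)
  have hLpos : (0:ℝ) < L := Nat.cast_pos.mpr hL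
  have hL'pos : (0:ℝ) < L' := Nat.cast_pos.mpr hL'
  have hle : (L:ℝ) ≤ (L':ℝ) := by exact_mod_cast hLL'
  set n : Fin 3 → ℕ := fun i => (k i).natAbs with hn
  set n' : Fin 3 → ℕ := fun i => (k' i).natAbs with hn'
  have hnn' : n ≤ n' := natAbs_le_of_abs_le hkk'
  have htp := stub_foldedBlockIntegral_tp2 stub_fourFunctions stub_foldedTent_tp2 Γ hK (L:ℝ) (L':ℝ) n' n hLpos hL'pos
  rw [max_eq_right hle, min_eq_left hle, sup_eq_left.mpr hnn', inf_eq_right.mpr hnn'] at htp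
  -- htp : F L n' * F L' n ≤ F L' n' * F L n
  by_cases hk' : k' = 0
  · have hk : k = 0 := eq_zero_of_abs_le_zero hkk' hk'
    subst hk; subst hk'
    exact le_rfl
  rw [bcK_rep Γ N L hL, bcK_rep Γ N L' hL', bcK_rep Γ N L hL, bcK_rep Γ N L' hL', if_neg hk', if_neg hk',
    bcK_cellSmear_eq h4 h5 h6 hK hL, bcK_cellSmear_eq h4 h5 h6 hK hL', bcK_cellSmear_eq h4 h5 h6 hK hL,
    bcK_cellSmear_eq h4 h5 h6 hK hL']
  have hA := pow_mul_foldedBlockIntegral_lt_top h4 h5 h6 hK hL k'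
  have hB := pow_mul_foldedBlockIntegral_lt_top h4 h5 h6 hK hL' k
  have hC := pow_mul_foldedBlockIntegral_lt_top h4 h5 h6 hK hL k
  have hD := pow_mul_foldedBlockIntegral_lt_top h4 h5 h6 hK hL' k'
  simp only [← hn, ← hn'] at hA hB hC hD ⊢
  set A := (L:ℝ≥0∞) ^ 6 * foldedBlockIntegral Γ L n' with hAdef
  set B := (L':ℝ≥0∞) ^ 6 * foldedBlockIntegral Γ L' n with hBdef
  set C := (L:ℝ≥0∞) ^ 6 * foldedBlockIntegral Γ L n with hCdef
  set D := (L':ℝ≥0∞) ^ 6 * foldedBlockIntegral Γ L' n' with hDdef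
  clear_value A B C D
  -- (i) smeared parts: A * B ≤ C * D
  have hi : A * B ≤ C * D := by
    calc A * B = ((L:ℝ≥0∞) ^ 6 * (L':ℝ≥0∞) ^ 6) *
          (foldedBlockIntegral Γ L n' * foldedBlockIntegral Γ L' n) := by rw [hAdef, hBdef]; ring
      _ ≤ ((L:ℝ≥0∞) ^ 6 * (L':ℝ≥0∞) ^ 6) *
          (foldedBlockIntegral Γ L' n' * foldedBlockIntegral Γ L n) := mul_le_mul_right htp _
      _ = C * D := by rw [hCdef, hDdef]; ring
  have hi' : A.toReal * B.toReal ≤ C.toReal * D.toReal := by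
    rw [← ENNReal.toReal_mul, ← ENNReal.toReal_mul]
    exact ENNReal.toReal_mono (ENNReal.mul_ne_top hC.ne hD.ne) hi
  by_cases hk : k = 0
  · -- nugget column only on the `k` side: (ii) L'³ A ≤ L³ D by the cubic column
    subst hk
    rw [if_pos rfl, if_pos rfl]
    have hcub := cubic_mono hK hLpos hle n'
    have eL : ENNReal.ofReal ((L:ℝ) ^ 3) = (L:ℝ≥0∞) ^ 3 := by
      rw [ENNReal.ofReal_pow (Nat.cast_nonneg L), ENNReal.ofReal_natCast]
    have eL' : ENNReal.ofReal ((L':ℝ) ^ 3) = (L':ℝ≥0∞) ^ 3 := by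
      rw [ENNReal.ofReal_pow (Nat.cast_nonneg L'), ENNReal.ofReal_natCast]
    rw [eL, eL'] at hcub
    have hii : (L':ℝ≥0∞) ^ 3 * A ≤ (L:ℝ≥0∞) ^ 3 * D := by
      calc (L':ℝ≥0∞) ^ 3 * A
          = ((L:ℝ≥0∞) ^ 3 * (L':ℝ≥0∞) ^ 3) * ((L:ℝ≥0∞) ^ 3 * foldedBlockIntegral Γ L n') := by
            rw [hAdef]; ring
        _ ≤ ((L:ℝ≥0∞) ^ 3 * (L':ℝ≥0∞) ^ 3) * ((L':ℝ≥0∞) ^ 3 * foldedBlockIntegral Γ L' n') :=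
            mul_le_mul_right hcub _
        _ = (L:ℝ≥0∞) ^ 3 * D := by rw [hDdef]; ring
    have hii' : ((L':ℝ)) ^ 3 * A.toReal ≤ ((L:ℝ)) ^ 3 * D.toReal := by
      have := ENNReal.toReal_mono (ENNReal.mul_ne_top (by simp) hD.ne) hii
      rw [ENNReal.toReal_mul, ENNReal.toReal_mul, ENNReal.toReal_pow, ENNReal.toReal_pow, ENNReal.toReal_natCast,
        ENNReal.toReal_natCast] at this
      exact this
    have hii'' : N * ((L':ℝ)) ^ 3 * A.toReal ≤ N * ((L:ℝ)) ^ 3 * D.toReal := by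
      rw [mul_assoc, mul_assoc]; exact mul_le_mul_of_nonneg_left hii' hN
    nlinarith [hi', hii'', ENNReal.toReal_nonneg (a := A), ENNReal.toReal_nonneg (a := B),
      ENNReal.toReal_nonneg (a := C), ENNReal.toReal_nonneg (a := D)]
  · rw [if_neg hk, if_neg hk]
    simpa using hi'

end Summit.CriticalPhenomena.Ising3DConformalLimit.Cruxes.MonotoneBlockingTwo.KarlinScaleTP2

end
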